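import Mathlib.LinearAlgebra.Matrix.ToLin
import Mathlib.LinearAlgebra.Determinant
import Mathlib.Topology.Algebra.Module.FiniteDimension
import Mathlib.Logic.Relation
import Literature.NumberTheory.Transcendental.KZCalculus
import Literature.NumberTheory.Transcendental.KZProductIdeal
import HarnessLib

/-!
# Level moves, descent rounds and common unfoldings in the KZ calculus

Definition request `defn-CommonUnfolding` of route KontsevichZagierPeriods/CommonUnfolding
(`Summits/KontsevichZagierPeriods/KontsevichZagierPeriods/Theses/CommonUnfolding.lean`; idea card
`every-valley-is-a-peak-common-unfolding`). Over the Kontsevich–Zagier calculus of moves of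
`KZCalculus.lean` (integral representations `[σ, f]`, the formal group `KZ.FormalRep`, the four
move sets `domainAddRel`, `integrandAddRel`, `changeOfVariablesRel`, `newtonLeibnizRel` and the
subgroup `KZ.relations` they generate) the route reads Kontsevich–Zagier's rule 3)
(Newton–Leibniz, [KZ 2001, §1.2]) FORWARDS — "integrate out the last variable, the fibrewise
primitive being `ℚ`-semialgebraic" — and organises derivations into

* LEVEL moves `KZ.levelRel`: the subgroup generated by domain additivity (1a), integrand
  additivity (1b) and the coordinate permutations `KZ.permRel` (the instances `x ↦ x ∘ p`,
  `p : Equiv.Perm (Fin d)`, of rule 2));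
* descent ROUNDS `KZ.Round C c`: `C` is massaged by level moves into a sum of bands `∑ [Bᵢ]`,
  and every band is replaced by its base through one Newton–Leibniz instance
  `[Bᵢ] − [bᵢ] ∈ newtonLeibnizRel`, `c = ∑ [bᵢ]`;
* COMMON UNFOLDINGS `KZ.CommonUnfolding r r'`: one representation `R` (the *peak*) and two chains
  of rounds from `[R]`, one ending level-equivalent to `[r]`, the other to `[r']`; the bounded
  variant `KZ.HasUnfoldingOfHeight h r r'` asks `dim R ≤ max (dim r) (dim r') + h`.

The five statement items of the route (stmt-KontsevichZagierPeriods-4827 … 4831) inline these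
objects as `let`s; the definitions below are the SAME terms, so that each item is definitionally
(`Iff.rfl`) equal to its restatement over this file — checked in a scratch file against the
Theses file for `CommonUnfoldingThesis`, `PeakNormalForm`, `TransportElimination` and
`HeightTwoPair` (the last as `∃ r r', r.IsRational ∧ r'.IsRational ∧ CommonUnfolding r r' ∧
¬ HasUnfoldingOfHeight 1 r r'`); a Literature file cannot import `Summits`, so the checks are not
shipped.

## Main definitions

* `Literature.NumberTheory.Transcendental.KZ.permRel`, `KZ.levelRel`, `KZ.Round`,
  `KZ.CommonUnfolding`, `KZ.HasUnfoldingOfHeight`.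

## Main statements (all proved)

* `KZ.permRel_subset_changeOfVariablesRel`: a coordinate permutation is a change-of-variables
  move (polynomial hence `ℚ`-semialgebraic map, injective, its own derivative, `|det| = 1`);
  hence `KZ.levelRel_le_relations`.
* Junk is level: `KZ.of_mem_levelRel_of_volume_eq_zero` (null domains),
  `KZ.of_mem_levelRel_of_eqOn_zero` (zero integrands), `KZ.of_add_of_neg_mem_levelRel`
  (`[σ, f] + [σ, −f]`, free cancellation).
* `KZ.Round.sub_mem_relations`: `Round C c → C − c ∈ relations`, and along chains of rounds
  `KZ.sub_mem_relations_of_reflTransGen_round`.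
* `KZ.CommonUnfolding.equivalent`: a common unfolding of `r`, `r'` gives `KZ.Equivalent r r'`
  (so `r.value = r'.value`, `KZ.CommonUnfolding.value_eq`). This is the soundness half
  ("Assembly") of the route; the converse (single-peak normal form) is the route's crux and is
  NOT claimed here.
* Structure: `CommonUnfolding` is reflexive and symmetric; `HasUnfoldingOfHeight` is monotone in
  the height and exhausts `CommonUnfolding` (`commonUnfolding_iff_exists_hasUnfoldingOfHeight`);
  height-`0` unfoldings from a level move (`hasUnfoldingOfHeight_zero_of_sub_mem_levelRel`), from
  a coordinate relabelling (`hasUnfoldingOfHeight_zero_reindex`, via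
  `KZ.of_sub_of_reindex_mem_permRel`) and from one Newton–Leibniz instance
  (`hasUnfoldingOfHeight_zero_of_mem_newtonLeibnizRel`, via `Round.single`).

## References

* M. Kontsevich, D. Zagier, *Periods*, in: Mathematics Unlimited — 2001 and Beyond, Springer
  (2001), 771–808 [KontsevichZagierPeriods2001]: §1.2, rules 1)–3) and Conjecture 1 (held preprint
  `paper:url-4812d7ce6862`, PDF pp. 7–8).
* M. H. A. Newman, *On theories with a combinatorial definition of "equivalence"*, Ann. of Math.
  43 (1942), 223–243 [Newman1942]: the rewriting vocabulary (descents from a common ancestor,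
  confluence) behind "common unfolding"; nothing of Newman's is formalised here.

## Design notes

* ROUTE-POSITED NOTIONS. `Round`, `CommonUnfolding`, `HasUnfoldingOfHeight` are the objects of a
  reformulation proposed inside this project (the idea card above), not notions in print; the
  docstrings say so. What is classical is tagged with its source: the move sets are
  Kontsevich–Zagier's rules, and `CommonUnfolding` is the abstract-rewriting notion "common
  ancestor under a reduction relation" instantiated at `Round` modulo `levelRel`.
* `permRel` asks equality of the integrands only on `s.domain` and fixes `s'` only through its
  domain and its integrand there, exactly as `changeOfVariablesRel` does.
* `Round C c` with `k = 0` bands reads `C ∈ levelRel ∧ c = 0`: junk (null domains, zero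
  integrands, antisymmetric sums) is invisible modulo `levelRel`, as intended by the route; no
  effectivity of `C` is imposed, matching the items as filed.
* `HasUnfoldingOfHeight h` bounds the height from ABOVE (`N ≤ max n m + h`), so that the route's
  "no unfolding with peak dimension `N ≤ 3`" for `n = m = 2` is `¬ HasUnfoldingOfHeight 1 r r'`
  definitionally (`max 2 2 + 1` reduces to `3`).
* `IntegralRep.reindex` (from `KZProductIdeal.lean`) is reused for the permutation witnesses
  rather than re-declared.
-/

noncomputable section

open MeasureTheory MvPolynomial Set

namespace Literature.NumberTheory.Transcendental

namespace KZ

variable {n m : ℕ}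

/-! ### Level moves -/

/-- **Coordinate permutations** as formal moves: `[s] − [s']` whenever, for some permutation
`p` of the coordinates of `ℝᵈ`, `s'.domain` is the image of `s.domain` under `x ↦ x ∘ p` and
`s.integrand x = s'.integrand (x ∘ p)` on `s.domain`. These are the instances of
Kontsevich–Zagier's rule 2) (change of variables) along the linear maps `x ↦ x ∘ p`, whose
Jacobian has absolute value `1` (`permRel_subset_changeOfVariablesRel`); route
KontsevichZagierPeriods/CommonUnfolding admits them — and no other change of variables — among its
level moves. [Kontsevich–Zagier 2001, §1.2, rule 2)] [cite: KontsevichZagierPeriods2001, §1.2 rule 2] -/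
def permRel : Set FormalRep :=
  {c | ∃ (d : ℕ) (s s' : IntegralRep d) (p : Equiv.Perm (Fin d)),
    s'.domain = (fun x : Fin d → ℝ => x ∘ ⇑p) '' s.domain ∧
    (∀ x ∈ s.domain, s.integrand x = s'.integrand (x ∘ ⇑p)) ∧ c = of s - of s'}

/-- **Level moves** of route KontsevichZagierPeriods/CommonUnfolding: the subgroup of
`FormalRep` generated by domain additivity (rule 1a, `domainAddRel`), integrand additivity
(rule 1b, `integrandAddRel`) and coordinate permutations (`permRel`) — no Newton–Leibniz
instance and no other change of variables is among the generators. The route's "junk" (empty or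
null domains, zero integrands, antisymmetric sums `[σ, f] + [σ, −f]`) lies in it, e.g.
`[∅, f] = [∅, f] + [∅, f]` is a domain-additivity instance. It is a subgroup of `relations`
(`levelRel_le_relations`).
[Kontsevich–Zagier 2001, §1.2, rules 1)–2)] [cite: KontsevichZagierPeriods2001, §1.2 rules 1–2] -/
def levelRel : AddSubgroup FormalRep :=
  AddSubgroup.closure (domainAddRel ∪ integrandAddRel ∪ permRel)

/-- Membership in `permRel`, unfolded. [Kontsevich–Zagier 2001, §1.2, rule 2)] [folklore] -/
theorem mem_permRel_iff {c : FormalRep} :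
    c ∈ permRel ↔ ∃ (d : ℕ) (s s' : IntegralRep d) (p : Equiv.Perm (Fin d)),
      s'.domain = (fun x : Fin d → ℝ => x ∘ ⇑p) '' s.domain ∧
      (∀ x ∈ s.domain, s.integrand x = s'.integrand (x ∘ ⇑p)) ∧ c = of s - of s' :=
  Iff.rfl

/-- `levelRel` unfolded: the closure of the three level move sets. [folklore] -/
theorem levelRel_def :
    levelRel = AddSubgroup.closure (domainAddRel ∪ integrandAddRel ∪ permRel) := rfl

/-- Domain additivity is a level move. [Kontsevich–Zagier 2001, §1.2, rule 1)] [folklore] -/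
theorem domainAddRel_subset_levelRel : domainAddRel ⊆ levelRel := fun _ hc =>
  AddSubgroup.subset_closure (Or.inl (Or.inl hc))

/-- Integrand additivity is a level move. [Kontsevich–Zagier 2001, §1.2, rule 1)] [folklore] -/
theorem integrandAddRel_subset_levelRel : integrandAddRel ⊆ levelRel := fun _ hc =>
  AddSubgroup.subset_closure (Or.inl (Or.inr hc))

/-- Coordinate permutations are level moves. [Kontsevich–Zagier 2001, §1.2, rule 2)] [folklore] -/
theorem permRel_subset_levelRel : permRel ⊆ levelRel := fun _ hc =>
  AddSubgroup.subset_closure (Or.inr hc)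

/-- **Null domains are junk**: a representation over a Lebesgue-null domain is a level move,
`[σ, f] ∈ levelRel` — from the domain-additivity instance `[σ, f] = [σ, f] + [σ, f]`
(`σ = σ ∪ σ`, `σ ∩ σ = σ` null). [Kontsevich–Zagier 2001, §1.2, rule 1)] [folklore] -/
theorem of_mem_levelRel_of_volume_eq_zero (r : IntegralRep n) (h : volume r.domain = 0) :
    of r ∈ levelRel := by
  have hmem : of r - of r - of r ∈ levelRel :=
    domainAddRel_subset_levelRel ⟨n, r, r, r, (union_self _).symm, by rwa [inter_self],
      fun _ _ => rfl, fun _ _ => rfl, rfl⟩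
  rw [sub_self, zero_sub] at hmem
  exact neg_mem_iff.mp hmem

/-- **Zero integrands are junk**: a representation whose integrand vanishes on its domain is a
level move, `[σ, f] ∈ levelRel` — from the integrand-additivity instance
`[σ, f] = [σ, f] + [σ, f]` (`f = f + f` on `σ` as `f = 0` there).
[Kontsevich–Zagier 2001, §1.2, rule 1)] [folklore] -/
theorem of_mem_levelRel_of_eqOn_zero (r : IntegralRep n) (h : EqOn r.integrand 0 r.domain) :
    of r ∈ levelRel := by
  have hmem : of r - of r - of r ∈ levelRel :=
    integrandAddRel_subset_levelRel ⟨n, r, r, r, rfl, rfl,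
      fun x hx => by rw [Pi.add_apply, h hx, Pi.zero_apply, add_zero], rfl⟩
  rw [sub_self, zero_sub] at hmem
  exact neg_mem_iff.mp hmem

/-- **Antisymmetric sums are junk**: `[σ, f] + [σ, −f] ∈ levelRel` (`IntegralRep.neg`). With
`r₀ = [σ, f + (−f)]` (a zero integrand, so `[r₀] ∈ levelRel` by `of_mem_levelRel_of_eqOn_zero`)
the integrand-additivity instance `[r₀] − [σ, f] − [σ, −f] ∈ integrandAddRel` gives
`[σ, f] + [σ, −f] = [r₀] − ([r₀] − [σ, f] − [σ, −f]) ∈ levelRel`. Signs thus "live in the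
integrand", which is the route's free cancellation. [Kontsevich–Zagier 2001, §1.2, rule 1)] [folklore] -/
theorem of_add_of_neg_mem_levelRel (r : IntegralRep n) : of r + of r.neg ∈ levelRel := by
  -- `r₀ = [σ, 0]`, realised with integrand `f + (-f)` (semialgebraic as the zero polynomial)
  let r₀ : IntegralRep n :=
    { domain := r.domain
      integrand := r.integrand + r.neg.integrand
      isSemialgebraic_domain := r.isSemialgebraic_domain
      isSemialgebraicFunOn_integrand :=
        (isSemialgebraicFunOn_aeval r.isSemialgebraic_domain (0 : MvPolynomial (Fin n) ℚ)).congr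
          fun x _ => by simp
      integrableOn := r.integrableOn.add r.neg.integrableOn }
  have h₀ : of r₀ ∈ levelRel :=
    of_mem_levelRel_of_eqOn_zero r₀ fun x _ => by simp [r₀]
  have h₁ : of r₀ - of r - of r.neg ∈ levelRel :=
    integrandAddRel_subset_levelRel ⟨n, r₀, r, r.neg, rfl, rfl, fun _ _ => rfl, rfl⟩
  have key : of r + of r.neg = of r₀ - (of r₀ - of r - of r.neg) := by abel
  rw [key]
  exact levelRel.sub_mem h₀ h₁

/-- **A coordinate permutation is a change-of-variables move.** For `p : Equiv.Perm (Fin d)` the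
map `Φ x = x ∘ p` of `ℝᵈ` is a `ℚ`-polynomial (hence `ℚ`-semialgebraic) map, injective, equal to
its own derivative (a continuous linear map, the permutation matrix `1.submatrix p id`), and
`|det Φ| = 1` (`Matrix.abs_det_submatrix_equiv_equiv`); so every element of `permRel` satisfies
the side conditions of `changeOfVariablesRel` on the nose.
[Kontsevich–Zagier 2001, §1.2, rule 2)] [cite: KontsevichZagierPeriods2001, §1.2 rule 2] -/
theorem permRel_subset_changeOfVariablesRel : permRel ⊆ changeOfVariablesRel := by
  rintro c ⟨d, s, s', p, hdom, hint, rfl⟩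
  -- the linear map `z ↦ z ∘ p` as a matrix
  let M : Matrix (Fin d) (Fin d) ℝ := (1 : Matrix (Fin d) (Fin d) ℝ).submatrix p (Equiv.refl _)
  let L : (Fin d → ℝ) →L[ℝ] (Fin d → ℝ) := LinearMap.toContinuousLinearMap (Matrix.toLin' M)
  have hL : ∀ z : Fin d → ℝ, L z = fun j => z (p j) := by
    intro z
    change Matrix.toLin' M z = _
    rw [Matrix.toLin'_apply, Matrix.submatrix_mulVec_equiv, Matrix.one_mulVec]
    rfl
  have hdet : |L.det| = 1 := by
    change |LinearMap.det (Matrix.toLin' M)| = 1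
    rw [LinearMap.det_toLin', Matrix.abs_det_submatrix_equiv_equiv, Matrix.det_one, abs_one]
  refine ⟨d, s, s', fun x => x ∘ ⇑p, fun _ => L, ?_, ?_, ?_, hdom, ?_, rfl⟩
  · -- semialgebraic: a coordinate (polynomial) map
    convert isSemialgebraicMapOn_aeval s.isSemialgebraic_domain
      (fun j => (X (p j) : MvPolynomial (Fin d) ℚ)) using 2 with z
    ext j; simp
  · intro z _
    have h := L.hasFDerivWithinAt (s := s.domain) (x := z)
    convert h using 1
    ext z' j
    rw [hL]
    rfl
  · intro z₁ _ z₂ _ h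
    ext i
    have := congrFun h (p.symm i)
    simpa using this
  · intro z hz
    rw [hdet, mul_one]
    exact hint z hz

/-- Coordinate permutations are relations of the KZ calculus.
[Kontsevich–Zagier 2001, §1.2, rule 2)] [folklore] -/
theorem permRel_subset_relations : permRel ⊆ relations := fun _ hc =>
  changeOfVariablesRel_subset_relations (permRel_subset_changeOfVariablesRel hc)

/-- **Level moves are relations**: `levelRel ≤ relations` (each generator is one of
Kontsevich–Zagier's rules 1a), 1b), 2)). [Kontsevich–Zagier 2001, §1.2] [folklore] -/
theorem levelRel_le_relations : levelRel ≤ relations := by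
  rw [levelRel_def]
  refine (AddSubgroup.closure_le _).mpr ?_
  rintro c ((hc | hc) | hc)
  · exact domainAddRel_subset_relations hc
  · exact integrandAddRel_subset_relations hc
  · exact permRel_subset_relations hc

/-- Level-equivalent formal combinations evaluate to the same number (soundness of the calculus,
`relations_le_ker_eval_holds`). [Kontsevich–Zagier 2001, §1.2] [folklore] -/
theorem eval_eq_of_sub_mem_levelRel {c c' : FormalRep} (h : c - c' ∈ levelRel) :
    eval c = eval c' := by
  have := relations_le_ker_eval_holds (levelRel_le_relations h)
  rwa [AddMonoidHom.mem_ker, map_sub, sub_eq_zero] at this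

/-- **Relabelling coordinates is a `permRel` instance**: for `r = [σ, f]` in dimension `n` and a
permutation `p`, `[r] − [r.reindex p] ∈ permRel` (`IntegralRep.reindex`, from
`KZProductIdeal.lean`, has domain `{w | (i ↦ w (p i)) ∈ σ} = (· ∘ p⁻¹) '' σ` and integrand
`w ↦ f (i ↦ w (p i))`; the witnessing permutation is `p⁻¹`). In particular `permRel` has
non-trivial elements. [Kontsevich–Zagier 2001, §1.2, rule 2)] [folklore] -/
theorem of_sub_of_reindex_mem_permRel (r : IntegralRep n) (p : Equiv.Perm (Fin n)) :
    of r - of (r.reindex p) ∈ permRel := by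
  refine ⟨n, r, r.reindex p, p.symm, ?_, ?_, rfl⟩
  · ext w
    simp only [IntegralRep.reindex_domain, mem_setOf_eq, mem_image]
    constructor
    · intro hw
      exact ⟨fun i => w (p i), hw, by ext j; simp⟩
    · rintro ⟨z, hz, rfl⟩
      simpa using hz
  · intro z _
    simp [IntegralRep.reindex_integrand]

/-! ### Descent rounds -/

/-- **One descent round** (route KontsevichZagierPeriods/CommonUnfolding; a route-posited notion,
not in print): `Round C c` holds if, for some dimension `d` and finitely many *bands*
`Bᵢ : IntegralRep (d + 1)` with *bases* `bᵢ : IntegralRep d`, each `[Bᵢ] − [bᵢ]` is a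
Newton–Leibniz instance (Kontsevich–Zagier's rule 3) read forwards: integrate out the last
variable, the fibrewise primitive being `ℚ`-semialgebraic), `C` is level-equivalent to `∑ [Bᵢ]`
(`C − ∑ [Bᵢ] ∈ levelRel`), and `c = ∑ [bᵢ]`. With `k = 0` bands it reads `C ∈ levelRel ∧ c = 0`.
[Kontsevich–Zagier 2001, §1.2, rule 3) — the move; the round is this project's packaging]
[cite: KontsevichZagierPeriods2001, §1.2 rule 3] -/
def Round (C c : FormalRep) : Prop :=
  ∃ (d k : ℕ) (B : Fin k → IntegralRep (d + 1)) (b : Fin k → IntegralRep d),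
    (∀ i, of (B i) - of (b i) ∈ newtonLeibnizRel) ∧ C - ∑ i, of (B i) ∈ levelRel ∧
    c = ∑ i, of (b i)

/-- `Round` unfolded. [folklore] -/
theorem round_iff {C c : FormalRep} :
    Round C c ↔ ∃ (d k : ℕ) (B : Fin k → IntegralRep (d + 1)) (b : Fin k → IntegralRep d),
      (∀ i, of (B i) - of (b i) ∈ newtonLeibnizRel) ∧ C - ∑ i, of (B i) ∈ levelRel ∧
      c = ∑ i, of (b i) :=
  Iff.rfl

/-- A single Newton–Leibniz instance `[B] − [b] ∈ newtonLeibnizRel` is a round `[B] ⟶ [b]`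
(one band, no level massage). [Kontsevich–Zagier 2001, §1.2, rule 3)] [folklore] -/
theorem Round.single {d : ℕ} {B : IntegralRep (d + 1)} {b : IntegralRep d}
    (h : of B - of b ∈ newtonLeibnizRel) : Round (of B) (of b) :=
  ⟨d, 1, fun _ => B, fun _ => b, fun _ => h,
    by rw [Fin.sum_univ_one, sub_self]; exact levelRel.zero_mem,
    by rw [Fin.sum_univ_one]⟩

/-- **Soundness of a round**: `Round C c → C − c ∈ relations`, since
`C − ∑ [bᵢ] = (C − ∑ [Bᵢ]) + ∑ ([Bᵢ] − [bᵢ])` with the first summand a level move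
(`levelRel_le_relations`) and each `[Bᵢ] − [bᵢ]` a Newton–Leibniz relation.
[Kontsevich–Zagier 2001, §1.2] [folklore] -/
theorem Round.sub_mem_relations {C c : FormalRep} (h : Round C c) : C - c ∈ relations := by
  obtain ⟨d, k, B, b, hNL, hC, rfl⟩ := h
  have hsum : ∑ i, (of (B i) - of (b i)) ∈ relations :=
    sum_mem fun i _ => newtonLeibnizRel_subset_relations (hNL i)
  have key : C - ∑ i, of (b i) = (C - ∑ i, of (B i)) + ∑ i, (of (B i) - of (b i)) := by
    rw [Finset.sum_sub_distrib]
    abel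
  rw [key]
  exact relations.add_mem (levelRel_le_relations hC) hsum

/-- Soundness along a chain of rounds: `C ⟶* c` implies `C − c ∈ relations` (induction on
`Relation.ReflTransGen`, telescoping `(C − b) + (b − c) = C − c`).
[Kontsevich–Zagier 2001, §1.2] [folklore] -/
theorem sub_mem_relations_of_reflTransGen_round {C c : FormalRep}
    (h : Relation.ReflTransGen Round C c) : C - c ∈ relations := by
  induction h with
  | refl => rw [sub_self]; exact relations.zero_mem
  | tail _ hbc ih =>
    have := relations.add_mem ih (Round.sub_mem_relations hbc)
    rwa [sub_add_sub_cancel] at this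

/-- A chain of rounds preserves the value: `C ⟶* c → eval C = eval c`.
[Kontsevich–Zagier 2001, §1.2] [folklore] -/
theorem eval_eq_of_reflTransGen_round {C c : FormalRep} (h : Relation.ReflTransGen Round C c) :
    eval C = eval c := by
  have := relations_le_ker_eval_holds (sub_mem_relations_of_reflTransGen_round h)
  rwa [AddMonoidHom.mem_ker, map_sub, sub_eq_zero] at this

/-! ### Common unfoldings -/

/-- **Common unfolding** of two integral representations `r` (dimension `n`) and `r'`
(dimension `m`) — the thesis object of route KontsevichZagierPeriods/CommonUnfolding (a
route-posited notion, not in print; in abstract-rewriting terms, `[r]` and `[r']` have a common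
ANCESTOR under the reduction `Round`, up to level moves — the vocabulary of Newman 1942): there are
a dimension `N`, ONE representation `R : IntegralRep N` (the *peak*) and two chains of descent
rounds from `[R]`, ending at formal combinations `c`, `c'` that are level-equivalent to `[r]`,
resp. `[r']`. Two such representations are KZ-equivalent (`CommonUnfolding.equivalent`); the
converse is the route's crux `PeakNormalForm` and is not asserted here.
[Kontsevich–Zagier 2001, §1.2 (the rules); Newman 1942 (vocabulary)] [folklore] -/
def CommonUnfolding (r : IntegralRep n) (r' : IntegralRep m) : Prop :=
  ∃ (N : ℕ) (R : IntegralRep N) (c c' : FormalRep),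
    Relation.ReflTransGen Round (of R) c ∧ Relation.ReflTransGen Round (of R) c' ∧
    c - of r ∈ levelRel ∧ c' - of r' ∈ levelRel

/-- **Common unfolding of height at most `h`**: as `CommonUnfolding r r'`, with the peak
dimension bounded by `N ≤ max n m + h` (the *height* of an unfolding is `N − max n m`; route
KontsevichZagierPeriods/CommonUnfolding, crux `HeightTwoPair`, asks for a pair of dimension `2`
with an unfolding but none of height `≤ 1`, i.e. `N ≤ 3`). Route-posited notion, not in print.
[Kontsevich–Zagier 2001, §1.2 (the rules); Newman 1942 (vocabulary)] [folklore] -/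
def HasUnfoldingOfHeight (h : ℕ) (r : IntegralRep n) (r' : IntegralRep m) : Prop :=
  ∃ (N : ℕ) (R : IntegralRep N) (c c' : FormalRep), N ≤ max n m + h ∧
    Relation.ReflTransGen Round (of R) c ∧ Relation.ReflTransGen Round (of R) c' ∧
    c - of r ∈ levelRel ∧ c' - of r' ∈ levelRel

/-- `CommonUnfolding` unfolded. [folklore] -/
theorem commonUnfolding_iff {r : IntegralRep n} {r' : IntegralRep m} :
    CommonUnfolding r r' ↔ ∃ (N : ℕ) (R : IntegralRep N) (c c' : FormalRep),
      Relation.ReflTransGen Round (of R) c ∧ Relation.ReflTransGen Round (of R) c' ∧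
      c - of r ∈ levelRel ∧ c' - of r' ∈ levelRel :=
  Iff.rfl

/-- `HasUnfoldingOfHeight` unfolded. [folklore] -/
theorem hasUnfoldingOfHeight_iff {h : ℕ} {r : IntegralRep n} {r' : IntegralRep m} :
    HasUnfoldingOfHeight h r r' ↔ ∃ (N : ℕ) (R : IntegralRep N) (c c' : FormalRep),
      N ≤ max n m + h ∧
      Relation.ReflTransGen Round (of R) c ∧ Relation.ReflTransGen Round (of R) c' ∧
      c - of r ∈ levelRel ∧ c' - of r' ∈ levelRel :=
  Iff.rfl

/-- A bounded-height unfolding is a common unfolding. [folklore] -/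
theorem HasUnfoldingOfHeight.commonUnfolding {h : ℕ} {r : IntegralRep n} {r' : IntegralRep m}
    (H : HasUnfoldingOfHeight h r r') : CommonUnfolding r r' := by
  obtain ⟨N, R, c, c', -, hc, hc', hr, hr'⟩ := H
  exact ⟨N, R, c, c', hc, hc', hr, hr'⟩

/-- Monotonicity in the height bound. [folklore] -/
theorem HasUnfoldingOfHeight.mono {h h' : ℕ} (hh : h ≤ h') {r : IntegralRep n}
    {r' : IntegralRep m} (H : HasUnfoldingOfHeight h r r') : HasUnfoldingOfHeight h' r r' := by
  obtain ⟨N, R, c, c', hN, hc, hc', hr, hr'⟩ := H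
  exact ⟨N, R, c, c', hN.trans (by omega), hc, hc', hr, hr'⟩

/-- A common unfolding has SOME height: `CommonUnfolding r r' ↔ ∃ h, HasUnfoldingOfHeight h r r'`.
[folklore] -/
theorem commonUnfolding_iff_exists_hasUnfoldingOfHeight {r : IntegralRep n} {r' : IntegralRep m} :
    CommonUnfolding r r' ↔ ∃ h, HasUnfoldingOfHeight h r r' := by
  constructor
  · rintro ⟨N, R, c, c', hc, hc', hr, hr'⟩
    exact ⟨N, N, R, c, c', Nat.le_add_left N _, hc, hc', hr, hr'⟩
  · rintro ⟨h, H⟩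
    exact H.commonUnfolding

/-- **Soundness of common unfoldings** (the "Assembly" direction of route
KontsevichZagierPeriods/CommonUnfolding): a common unfolding of `r` and `r'` makes them
KZ-equivalent, since `[r] − [r'] = ([R] − c') + (c' − [r']) − ([R] − c) − (c − [r])` with the
four brackets relations (`sub_mem_relations_of_reflTransGen_round`, `levelRel_le_relations`).
[Kontsevich–Zagier 2001, §1.2] [folklore] -/
theorem CommonUnfolding.equivalent {r : IntegralRep n} {r' : IntegralRep m}
    (h : CommonUnfolding r r') : Equivalent r r' := by
  obtain ⟨N, R, c, c', hc, hc', hr, hr'⟩ := h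
  have h₁ := sub_mem_relations_of_reflTransGen_round hc
  have h₂ := sub_mem_relations_of_reflTransGen_round hc'
  have h₃ := levelRel_le_relations hr
  have h₄ := levelRel_le_relations hr'
  have key : of r - of r' = (of R - c') + (c' - of r') - (of R - c) - (c - of r) := by abel
  show of r - of r' ∈ relations
  rw [key]
  exact relations.sub_mem (relations.sub_mem (relations.add_mem h₂ h₄) h₁) h₃

/-- Representations with a common unfolding represent the same number
(`CommonUnfolding.equivalent` and soundness of the calculus `Equivalent.value_eq_holds`).
[Kontsevich–Zagier 2001, §1.2] [folklore] -/
theorem CommonUnfolding.value_eq {r : IntegralRep n} {r' : IntegralRep m}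
    (h : CommonUnfolding r r') : r.value = r'.value :=
  Equivalent.value_eq_holds h.equivalent

/-- A bounded-height unfolding makes the two representations KZ-equivalent. [folklore] -/
theorem HasUnfoldingOfHeight.equivalent {h : ℕ} {r : IntegralRep n} {r' : IntegralRep m}
    (H : HasUnfoldingOfHeight h r r') : Equivalent r r' :=
  H.commonUnfolding.equivalent

/-- `CommonUnfolding` is symmetric (swap the two descents). [folklore] -/
protected theorem CommonUnfolding.symm {r : IntegralRep n} {r' : IntegralRep m}
    (h : CommonUnfolding r r') : CommonUnfolding r' r := by
  obtain ⟨N, R, c, c', hc, hc', hr, hr'⟩ := h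
  exact ⟨N, R, c', c, hc', hc, hr', hr⟩

/-- `HasUnfoldingOfHeight h` is symmetric (swap the two descents). [folklore] -/
protected theorem HasUnfoldingOfHeight.symm {h : ℕ} {r : IntegralRep n} {r' : IntegralRep m}
    (H : HasUnfoldingOfHeight h r r') : HasUnfoldingOfHeight h r' r := by
  obtain ⟨N, R, c, c', hN, hc, hc', hr, hr'⟩ := H
  exact ⟨N, R, c', c, by rwa [max_comm], hc', hc, hr', hr⟩

/-- **Level moves unfold at height `0`**: if `[r] − [r'] ∈ levelRel` (same dimension) then `r`
itself is a peak: `R = r`, both chains empty, `c = c' = [r]`. [folklore] -/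
theorem hasUnfoldingOfHeight_zero_of_sub_mem_levelRel {r r' : IntegralRep n}
    (h : of r - of r' ∈ levelRel) : HasUnfoldingOfHeight 0 r r' :=
  ⟨n, r, of r, of r, by omega, Relation.ReflTransGen.refl, Relation.ReflTransGen.refl,
    by rw [sub_self]; exact levelRel.zero_mem, h⟩

/-- `HasUnfoldingOfHeight 0` (hence `CommonUnfolding`) is reflexive. [folklore] -/
protected theorem HasUnfoldingOfHeight.refl (r : IntegralRep n) : HasUnfoldingOfHeight 0 r r :=
  hasUnfoldingOfHeight_zero_of_sub_mem_levelRel (by rw [sub_self]; exact levelRel.zero_mem)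

/-- `CommonUnfolding` is reflexive. [folklore] -/
protected theorem CommonUnfolding.refl (r : IntegralRep n) : CommonUnfolding r r :=
  (HasUnfoldingOfHeight.refl r).commonUnfolding

/-- **Coordinate relabellings unfold at height `0`**: `r` and `r.reindex p` (`p` a permutation
of the coordinates) have a common unfolding with peak `r` (`of_sub_of_reindex_mem_permRel`).
[folklore] -/
theorem hasUnfoldingOfHeight_zero_reindex (r : IntegralRep n) (p : Equiv.Perm (Fin n)) :
    HasUnfoldingOfHeight 0 r (r.reindex p) :=
  hasUnfoldingOfHeight_zero_of_sub_mem_levelRel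
    (permRel_subset_levelRel (of_sub_of_reindex_mem_permRel r p))

/-- **A Newton–Leibniz instance unfolds at height `0`**: if `[B] − [b] ∈ newtonLeibnizRel`
(band `B` in dimension `d + 1`, base `b` in dimension `d`) then the band itself is a peak:
`R = B`, the empty chain to `[B]` and the one-round chain `[B] ⟶ [b]` (`Round.single`).
[Kontsevich–Zagier 2001, §1.2, rule 3)] [folklore] -/
theorem hasUnfoldingOfHeight_zero_of_mem_newtonLeibnizRel {d : ℕ} {B : IntegralRep (d + 1)}
    {b : IntegralRep d} (h : of B - of b ∈ newtonLeibnizRel) : HasUnfoldingOfHeight 0 B b :=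
  ⟨d + 1, B, of B, of b, by omega, Relation.ReflTransGen.refl,
    Relation.ReflTransGen.single (Round.single h),
    by rw [sub_self]; exact levelRel.zero_mem, by rw [sub_self]; exact levelRel.zero_mem⟩

end KZ

end Literature.NumberTheory.Transcendental
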